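import Literature.Geometry.Lorentzian.GreenIdentityCompactSupport
import Literature.Geometry.Lorentzian.VolumeProofs
import Literature.Geometry.Lorentzian.EnergyCurrents
import Literature.Geometry.Riemannian.RelativeL2HarmonicOneForms
import Literature.Geometry.Riemannian.RiemannianDistance
import Mathlib.Geometry.Manifold.PartitionOfUnity
import HarnessLib

/-!
# The harmonic representative of a Dirichlet-energy minimiser has finite energy `∫ |dũ|² ≤ m`,
# and its differential is a smooth section (Carron 2007, Prop. 2.5: "`dh = η ∈ L²`")

Fifth layer (analysis, part D) of the proof programme of
`Literature.Geometry.Riemannian.Carron1998_ends_le_rank_l2HarmonicOneForms`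
(`L2HarmonicOneFormsSobolev.lean`). In G. Carron, *L² harmonic forms on non-compact Riemannian
manifolds*, arXiv:0704.3194 (2007), Prop. 2.5, the harmonic function `h = u - v` of an end has
`dh = η ∈ L²` because `η` is the `L²`-limit of the exact forms `d(u - v_k)`; Remark 2.6 obtains
the same bound as `∫ |du|² ≤ ∫ |du_k|² < ∞` for the variational solution. In the variational
form followed by this tree (minimising `E(v) = ∫ |d(χ - v)|²` over `v ∈ C_c^∞`,
`DirichletEnergyMinimisers.lean`, with harmonic representative `ũ` of the `L^q` limit,
`DirichletMinimiserHarmonic.lean` and the tree's smooth-test elliptic regularity), the energy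
bound is obtained WITHOUT a divergence theorem for general `1`-forms, by testing against the
compactly supported forms `φ dũ`: Green's first identity gives
`∫ φ h⁻¹(dw, dũ) = -∫ w h⁻¹(dφ, dũ)` for every smooth `w` when `Δ_h ũ = 0`, so
`∫ φ |dũ|² = lim ∫ φ h⁻¹(d(χ - vₙ), dũ) ≤ lim √E(vₙ) · √(∫ φ |dũ|²) = √m √(∫ φ |dũ|²)`.
For a Riemannian manifold `(N, h)` (boundaryless real model; for the Green identity, modelled on
`ℝ^m`), this file PROVES

* `contMDiffAt_oneFormSection_mvfderiv` — **the differential of a `C^∞` function is a `C^∞`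
  section of `T*N`** (Mathlib's `ContMDiffAt.mfderiv_const` read through `contMDiffAt_hom_bundle`);
* `integral_mul_innerDual_mvfderiv_eq_neg` — for `ũ ∈ C^∞` harmonic, `w ∈ C^∞`, `φ ∈ C_c^∞`:
  `∫ φ h⁻¹(dw, dũ) dV_h = -∫ w h⁻¹(dφ, dũ) dV_h` (Green's identity with `u = φ w`, `d(φw) = φ dw + w dφ`);
* `integral_mul_gradSq_le_of_tendsto` — **the energy bound on a cutoff**: if `E(vₙ) → m`,
  `∫ ((χ - vₙ) - ũ) F → 0` for continuous compactly supported `F` (the `L^q` convergence), `ũ`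
  smooth harmonic, then `∫ φ |dũ|²_h ≤ m` for every `φ ∈ C_c^∞(N; [0,1])`;
* `lintegral_ofReal_le_of_forall_cutoff` — from the bounds on all such cutoffs to
  `∫⁻ ofReal |dũ|²_h ≤ ofReal m` (a compact exhaustion and smooth Urysohn functions).

Everything is proved; no definitions, no named facts (D-0026).

## References

* G. Carron, *L² harmonic forms on non-compact Riemannian manifolds*, arXiv:0704.3194 (2007),
  Prop. 2.5 and Remark 2.6. [`Carron2007`]
* J. M. Lee, *Introduction to Riemannian Manifolds*, 2nd ed. (2018), Problem 2-23 (a).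
  [`Lee2018`]
-/

noncomputable section

open Bundle Set Function Filter Topology MeasureTheory
open scoped Manifold ContDiff ENNReal NNReal

namespace Literature.Geometry.Riemannian

open Literature.Geometry.Lorentzian
open Literature.Geometry.Lorentzian.PseudoRiemannianMetric

/-! ### The differential of a smooth function is a smooth cotangent section -/

section Section

variable {E : Type*} [NormedAddCommGroup E] [NormedSpace ℝ E] {H : Type*} [TopologicalSpace H]
  {I : ModelWithCorners ℝ E H} {X : Type*} [TopologicalSpace X] [ChartedSpace H X]
  [IsManifold I ∞ X]

set_option backward.isDefEq.respectTransparency false in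
/-- **`du` is a `C^∞` section of `T*X` for `u ∈ C^∞`** (at a point: if `u` is `C^∞` at `x₀`
then `x ↦ du_x ∈ T*_x X` is a `C^∞` section of `Hom(TX, ℝ)` at `x₀`): in the trivialisations
of `TX` at `x₀` and of the trivial bundle, the section reads
`x ↦ du_x ∘ (coordinate change)`, which is Mathlib's `inTangentCoordinates I 𝓘(ℝ, ℝ) id u du x₀`
(`ContMDiffAt.mfderiv_const`), the trivialisation of `Tℝ` being the identity. [folklore] -/
theorem contMDiffAt_oneFormSection_mvfderiv {u : X → ℝ} {x₀ : X}
    (hu : ContMDiffAt I 𝓘(ℝ, ℝ) ∞ u x₀) :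
    ContMDiffAt I (I.prod 𝓘(ℝ, E →L[ℝ] ℝ)) ∞ (oneFormSection (mvfderiv I u)) x₀ := by
  rw [contMDiffAt_hom_bundle]
  refine ⟨contMDiffAt_id, ?_⟩
  have h := hu.mfderiv_const (m := ∞) le_rfl
  refine h.congr_of_eventuallyEq ?_
  filter_upwards [(chartAt H x₀).open_source.mem_nhds (mem_chart_source H x₀)] with x hx
  have h1 : (trivializationAt ℝ (fun _ : X ↦ ℝ) x₀).continuousLinearMapAt ℝ x =
      ContinuousLinearMap.id ℝ ℝ :=
    Bundle.Trivial.continuousLinearMapAt_trivialization ℝ X ℝ x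
  have h2 : (trivializationAt ℝ (TangentSpace 𝓘(ℝ, ℝ)) (u x₀)).continuousLinearMapAt ℝ (u x) =
      (1 : ℝ →L[ℝ] ℝ) :=
    TangentBundle.continuousLinearMapAt_model_space (u x₀) (u x)
  ext v
  simp only [inTangentCoordinates, ContinuousLinearMap.inCoordinates,
    ContinuousLinearMap.coe_comp, Function.comp_apply, mvfderiv, h1, h2, id_eq,
    ContinuousLinearMap.id_apply]
  rfl

/-- Global form: for `u ∈ C^∞(X)` the differential is a `C^∞` section of `T*X`. [folklore] -/
theorem contMDiff_oneFormSection_mvfderiv {u : X → ℝ} (hu : ContMDiff I 𝓘(ℝ, ℝ) ∞ u) (x : X) :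
    ContMDiffAt I (I.prod 𝓘(ℝ, E →L[ℝ] ℝ)) ∞ (oneFormSection (mvfderiv I u)) x :=
  contMDiffAt_oneFormSection_mvfderiv (hu x)

end Section

/-! ### Testing against `φ dũ`: Green's identity with `u = φ w` -/

section Energy

variable {m : ℕ} {H : Type*} [TopologicalSpace H]
  {I : ModelWithCorners ℝ (EuclideanSpace ℝ (Fin m)) H} [I.Boundaryless]
  {N : Type*} [TopologicalSpace N] [ChartedSpace H N] [IsManifold I ∞ N]
  [T3Space N] [SecondCountableTopology N] [MeasurableSpace N] [BorelSpace N]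
  (h : ContMDiffRiemannianMetric I ∞ (EuclideanSpace ℝ (Fin m)) (TangentSpace I : N → Type _))
  [(ofRiemannian h).HasLeviCivita]

/-- **Green's identity tested on `φ dũ`**: for `ũ ∈ C^∞(N)` harmonic (`Δ_h ũ = 0`), `w ∈ C^∞(N)`
and `φ ∈ C_c^∞(N)`, `∫ φ h⁻¹(dw, dũ) dV_h = -∫ w h⁻¹(dφ, dũ) dV_h`. Proof: Green's first identity
`∫ (φ w) Δ_h ũ = -∫ h⁻¹(d(φ w), dũ)` (`integral_mul_dalembertian_eq_neg_integral_innerDual_of_hasCompactSupport`)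
with `Δ_h ũ = 0` and `d(φ w) = φ dw + w dφ`. This replaces a divergence theorem for the compactly
supported `1`-form `φ w dũ`. [cite: Carron2007, Prop. 2.5] -/
theorem integral_mul_innerDual_mvfderiv_eq_neg {ũ w φ : N → ℝ} (hũ : ContMDiff I 𝓘(ℝ, ℝ) ∞ ũ)
    (hΔ : ∀ x, (ofRiemannian h).dalembertian ũ x = 0) (hw : ContMDiff I 𝓘(ℝ, ℝ) ∞ w)
    (hφ : ContMDiff I 𝓘(ℝ, ℝ) ∞ φ) (hφc : HasCompactSupport φ) :
    ∫ x, φ x * (ofRiemannian h).innerDual x (mvfderiv I w x).toLinearMap (mvfderiv I ũ x).toLinearMap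
        ∂riemannianMeasure h =
      -∫ x, w x * (ofRiemannian h).innerDual x (mvfderiv I φ x).toLinearMap
        (mvfderiv I ũ x).toLinearMap ∂riemannianMeasure h := by
  haveI : LocallyCompactSpace N := Manifold.locallyCompact_of_finiteDimensional I
  haveI : IsFiniteMeasureOnCompacts (riemannianMeasure h) :=
    ⟨fun K hK ↦ riemannianVolume_lt_top_of_isCompact_holds h le_rfl hK⟩
  -- Green's identity for `u = φ w`
  have hu1 : CMDiff 1 (fun x ↦ φ x * w x) := by
    exact_mod_cast contMDiff_infty.1 (hφ.mul hw) 1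
  have huc : HasCompactSupport (fun x ↦ φ x * w x) := hφc.mul_right
  have hũ2 : CMDiff 2 ũ := by exact_mod_cast contMDiff_infty.1 hũ 2
  have hG := integral_mul_dalembertian_eq_neg_integral_innerDual_of_hasCompactSupport h hu1 huc hũ2
  have hL : ∫ x, φ x * w x * (ofRiemannian h).dalembertian ũ x ∂riemannianMeasure h = 0 := by
    simp only [hΔ, mul_zero, integral_zero]
  rw [hL] at hG
  -- the product rule `d(φ w) = φ dw + w dφ`, and bilinearity of `h⁻¹`
  have hφ1 : CMDiff 1 φ := by exact_mod_cast contMDiff_infty.1 hφ 1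
  have hw1 : CMDiff 1 w := by exact_mod_cast contMDiff_infty.1 hw 1
  have hũ1 : CMDiff 1 ũ := by exact_mod_cast contMDiff_infty.1 hũ 1
  have hpt : ∀ x, (ofRiemannian h).innerDual x (mvfderiv I (fun x ↦ φ x * w x) x).toLinearMap
      (mvfderiv I ũ x).toLinearMap =
      φ x * (ofRiemannian h).innerDual x (mvfderiv I w x).toLinearMap (mvfderiv I ũ x).toLinearMap +
      w x * (ofRiemannian h).innerDual x (mvfderiv I φ x).toLinearMap (mvfderiv I ũ x).toLinearMap := by
    intro x
    have hdφ : MDiffAt φ x := (hφ1 x).mdifferentiableAt one_ne_zero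
    have hdw : MDiffAt w x := (hw1 x).mdifferentiableAt one_ne_zero
    rw [mvfderiv_fun_mul hdφ hdw]
    simp only [PseudoRiemannianMetric.innerDual, ContinuousLinearMap.toLinearMap_add,
      ContinuousLinearMap.toLinearMap_smul, LinearMap.add_apply, LinearMap.smul_apply, smul_eq_mul]
  -- integrability of both terms (continuous with compact support in `tsupport φ`)
  have hc1 : Continuous fun x ↦ (ofRiemannian h).innerDual x (mvfderiv I w x).toLinearMap
      (mvfderiv I ũ x).toLinearMap := continuous_innerDual_mvfderiv _ hw1 hũ1
  have hc2 : Continuous fun x ↦ (ofRiemannian h).innerDual x (mvfderiv I φ x).toLinearMap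
      (mvfderiv I ũ x).toLinearMap := continuous_innerDual_mvfderiv _ hφ1 hũ1
  have hI1 : Integrable (fun x ↦ φ x * (ofRiemannian h).innerDual x (mvfderiv I w x).toLinearMap
      (mvfderiv I ũ x).toLinearMap) (riemannianMeasure h) :=
    (hφ.continuous.mul hc1).integrable_of_hasCompactSupport hφc.mul_right
  have hs2 : HasCompactSupport fun x ↦ w x * (ofRiemannian h).innerDual x (mvfderiv I φ x).toLinearMap
      (mvfderiv I ũ x).toLinearMap := by
    refine HasCompactSupport.of_support_subset_isCompact hφc.isCompact fun x hx ↦ ?_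
    by_contra hx'
    apply hx
    simp [PseudoRiemannianMetric.innerDual, mvfderiv_eq_zero_of_notMem_tsupport hx']
  have hI2 : Integrable (fun x ↦ w x * (ofRiemannian h).innerDual x (mvfderiv I φ x).toLinearMap
      (mvfderiv I ũ x).toLinearMap) (riemannianMeasure h) :=
    (hw.continuous.mul hc2).integrable_of_hasCompactSupport hs2
  have hsplit : ∫ x, (ofRiemannian h).innerDual x (mvfderiv I (fun x ↦ φ x * w x) x).toLinearMap
      (mvfderiv I ũ x).toLinearMap ∂riemannianMeasure h =
      (∫ x, φ x * (ofRiemannian h).innerDual x (mvfderiv I w x).toLinearMap (mvfderiv I ũ x).toLinearMap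
        ∂riemannianMeasure h) +
      ∫ x, w x * (ofRiemannian h).innerDual x (mvfderiv I φ x).toLinearMap (mvfderiv I ũ x).toLinearMap
        ∂riemannianMeasure h := by
    rw [← integral_add hI1 hI2]
    exact integral_congr_ae (Eventually.of_forall hpt)
  rw [hsplit] at hG
  linarith

/-- **The energy bound on a cutoff** (Carron 2007, Prop. 2.5: `dh = η ∈ L²`, `η = L²-lim d(u - v_k)`).
Let `χ, ũ ∈ C^∞(N)` with `Δ_h ũ = 0`, `vₙ ∈ C_c^∞(N)` with energies
`E(vₙ) = ∫ |d(χ - vₙ)|²_h → m`, and suppose `∫ ((χ - vₙ) - ũ) F dV_h → 0` for every continuous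
compactly supported `F` (the `L^q` convergence of `χ - vₙ` to `ũ`). Then for every
`φ ∈ C_c^∞(N)` with `0 ≤ φ ≤ 1`: `∫ φ |dũ|²_h dV_h ≤ m`. Proof:
`∫ φ |dũ|² = -∫ ũ h⁻¹(dφ, dũ) = lim (-∫ (χ - vₙ) h⁻¹(dφ, dũ)) = lim ∫ φ h⁻¹(d(χ - vₙ), dũ)`
(`integral_mul_innerDual_mvfderiv_eq_neg` twice) and, by Cauchy–Schwarz pointwise and in `L²`,
`|∫ φ h⁻¹(d(χ - vₙ), dũ)| ≤ √E(vₙ) √(∫ φ |dũ|²)`. [cite: Carron2007, Prop. 2.5] -/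
theorem integral_mul_gradSq_le_of_tendsto {χ ũ : N → ℝ} (hχ : ContMDiff I 𝓘(ℝ, ℝ) ∞ χ)
    (hũ : ContMDiff I 𝓘(ℝ, ℝ) ∞ ũ) (hΔ : ∀ x, (ofRiemannian h).dalembertian ũ x = 0)
    {v : ℕ → N → ℝ} (hv : ∀ n, ContMDiff I 𝓘(ℝ, ℝ) ∞ (v n)) (hvc : ∀ n, HasCompactSupport (v n))
    {K₁ : Set N} (hK₁ : IsCompact K₁) (hχK : ∀ x ∉ K₁, mvfderiv I χ x = 0) {m' : ℝ}
    (hE : Tendsto (fun n ↦ ∫ x, (ofRiemannian h).gradSq (χ - v n) x ∂riemannianMeasure h)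
      atTop (𝓝 m'))
    (hconv : ∀ F : N → ℝ, Continuous F → HasCompactSupport F →
      Tendsto (fun n ↦ ∫ x, ((χ x - v n x) - ũ x) * F x ∂riemannianMeasure h) atTop (𝓝 0))
    {φ : N → ℝ} (hφ : ContMDiff I 𝓘(ℝ, ℝ) ∞ φ) (hφc : HasCompactSupport φ)
    (hφ0 : ∀ x, 0 ≤ φ x) (hφ1 : ∀ x, φ x ≤ 1) :
    ∫ x, φ x * (ofRiemannian h).gradSq ũ x ∂riemannianMeasure h ≤ m' := by
  haveI : LocallyCompactSpace N := Manifold.locallyCompact_of_finiteDimensional I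
  haveI : IsFiniteMeasureOnCompacts (riemannianMeasure h) :=
    ⟨fun K hK ↦ riemannianVolume_lt_top_of_isCompact_holds h le_rfl hK⟩
  have hg : (ofRiemannian h).IsRiemannian := isRiemannian_ofRiemannian h
  set ν : Measure N := riemannianMeasure h with hν
  have hũ1 : CMDiff 1 ũ := by exact_mod_cast contMDiff_infty.1 hũ 1
  have hφ1' : CMDiff 1 φ := by exact_mod_cast contMDiff_infty.1 hφ 1
  -- the test field `F = h⁻¹(dφ, dũ)`, continuous with compact support
  set F : N → ℝ := fun x ↦ (ofRiemannian h).innerDual x (mvfderiv I φ x).toLinearMap (mvfderiv I ũ x).toLinearMap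
    with hF
  have hFc : Continuous F := continuous_innerDual_mvfderiv _ hφ1' hũ1
  have hFs : HasCompactSupport F := by
    refine HasCompactSupport.of_support_subset_isCompact hφc.isCompact fun x hx ↦ ?_
    by_contra hx'
    apply hx
    simp [hF, PseudoRiemannianMetric.innerDual, mvfderiv_eq_zero_of_notMem_tsupport hx']
  -- `G = |dũ|²`, and `T = ∫ φ G = -∫ ũ F`
  set G : N → ℝ := (ofRiemannian h).gradSq ũ with hGdef
  have hG0 : ∀ x, 0 ≤ G x := fun x ↦ innerDual_self_nonneg (h := h) x _
  have hGc : Continuous G := continuous_innerDual_mvfderiv _ hũ1 hũ1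
  set T : ℝ := ∫ x, φ x * G x ∂ν with hTdef
  have hT0 : 0 ≤ T := integral_nonneg fun x ↦ mul_nonneg (hφ0 x) (hG0 x)
  have hTeq : T = -∫ x, ũ x * F x ∂ν := integral_mul_innerDual_mvfderiv_eq_neg h hũ hΔ hũ hφ hφc
  -- `Tₙ = ∫ φ h⁻¹(d(χ - vₙ), dũ) = -∫ (χ - vₙ) F`
  set Tn : ℕ → ℝ := fun n ↦ ∫ x, φ x * (ofRiemannian h).innerDual x (mvfderiv I (χ - v n) x).toLinearMap
    (mvfderiv I ũ x).toLinearMap ∂ν with hTn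
  have hTn_eq : ∀ n, Tn n = -∫ x, (χ x - v n x) * F x ∂ν := fun n ↦
    integral_mul_innerDual_mvfderiv_eq_neg h hũ hΔ (hχ.sub (hv n)) hφ hφc
  -- `Tₙ → T`
  have hlim : Tendsto Tn atTop (𝓝 T) := by
    have hIũ : Integrable (fun x ↦ ũ x * F x) ν :=
      (hũ.continuous.mul hFc).integrable_of_hasCompactSupport hFs.mul_left
    have hIn : ∀ n, Integrable (fun x ↦ (χ x - v n x) * F x) ν := fun n ↦
      ((hχ.sub (hv n)).continuous.mul hFc).integrable_of_hasCompactSupport hFs.mul_left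
    have h1 := hconv F hFc hFs
    have h2 : ∀ n, Tn n - T = -∫ x, ((χ x - v n x) - ũ x) * F x ∂ν := by
      intro n
      have h3 : ∫ x, ((χ x - v n x) - ũ x) * F x ∂ν =
          (∫ x, (χ x - v n x) * F x ∂ν) - ∫ x, ũ x * F x ∂ν := by
        rw [← integral_sub (hIn n) hIũ]
        exact integral_congr_ae (Eventually.of_forall fun x ↦ by ring)
      rw [hTn_eq n, hTeq, h3]
      ring
    have h3 : Tendsto (fun n ↦ Tn n - T) atTop (𝓝 0) := by
      simp_rw [h2]
      simpa using h1.neg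
    have h4 := h3.add_const T
    simpa using h4
  -- `|Tₙ| ≤ √Eₙ √T`
  have hbound : ∀ n, |Tn n| ≤ Real.sqrt (∫ x, (ofRiemannian h).gradSq (χ - v n) x ∂ν) * Real.sqrt T := by
    intro n
    have hw1 : CMDiff 1 (χ - v n) := by exact_mod_cast contMDiff_infty.1 (hχ.sub (hv n)) 1
    set a : N → ℝ := fun x ↦ Real.sqrt (φ x * (ofRiemannian h).gradSq (χ - v n) x) with ha
    set b : N → ℝ := fun x ↦ Real.sqrt (φ x * G x) with hb
    have hgn0 : ∀ x, 0 ≤ (ofRiemannian h).gradSq (χ - v n) x := fun x ↦ innerDual_self_nonneg (h := h) x _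
    have hgc : Continuous ((ofRiemannian h).gradSq (χ - v n)) := continuous_innerDual_mvfderiv _ hw1 hw1
    have hac : Continuous a := (hφ.continuous.mul hgc).sqrt
    have hbc : Continuous b := (hφ.continuous.mul hGc).sqrt
    have has : HasCompactSupport a := by
      refine HasCompactSupport.of_support_subset_isCompact hφc.isCompact fun x hx ↦ ?_
      by_contra hx'
      apply hx
      simp [ha, image_eq_zero_of_notMem_tsupport hx']
    have hbs : HasCompactSupport b := by
      refine HasCompactSupport.of_support_subset_isCompact hφc.isCompact fun x hx ↦ ?_
      by_contra hx'
      apply hx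
      simp [hb, image_eq_zero_of_notMem_tsupport hx']
    -- pointwise: `|φ h⁻¹(dwₙ, dũ)| ≤ a b`
    have hpt : ∀ x, |φ x * (ofRiemannian h).innerDual x (mvfderiv I (χ - v n) x).toLinearMap
        (mvfderiv I ũ x).toLinearMap| ≤ a x * b x := by
      intro x
      rw [abs_mul, abs_of_nonneg (hφ0 x), ha, hb]
      dsimp only
      rw [Real.sqrt_mul (hφ0 x), Real.sqrt_mul (hφ0 x)]
      -- Cauchy–Schwarz for `h⁻¹` (an inner product through `♯`)
      have hcs : |(ofRiemannian h).innerDual x (mvfderiv I (χ - v n) x).toLinearMap (mvfderiv I ũ x).toLinearMap| ≤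
          Real.sqrt ((ofRiemannian h).gradSq (χ - v n) x) * Real.sqrt (G x) := by
        letI := (ofRiemannian h).riemannianBundle hg
        simp only [hGdef, PseudoRiemannianMetric.gradSq]
        rw [PseudoRiemannianMetric.innerDual_eq_val_sharp_sharp,
          PseudoRiemannianMetric.innerDual_eq_val_sharp_sharp,
          PseudoRiemannianMetric.innerDual_eq_val_sharp_sharp, ← (ofRiemannian h).inner_eq hg, ← (ofRiemannian h).inner_eq hg,
          ← (ofRiemannian h).inner_eq hg, real_inner_self_eq_norm_sq, real_inner_self_eq_norm_sq,
          Real.sqrt_sq (norm_nonneg _), Real.sqrt_sq (norm_nonneg _)]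
        exact abs_real_inner_le_norm _ _
      calc φ x * |(ofRiemannian h).innerDual x (mvfderiv I (χ - v n) x).toLinearMap (mvfderiv I ũ x).toLinearMap|
          ≤ φ x * (Real.sqrt ((ofRiemannian h).gradSq (χ - v n) x) * Real.sqrt (G x)) :=
            mul_le_mul_of_nonneg_left hcs (hφ0 x)
        _ = Real.sqrt (φ x) * Real.sqrt ((ofRiemannian h).gradSq (χ - v n) x) * (Real.sqrt (φ x) * Real.sqrt (G x)) := by
            have key : ∀ s a b : ℝ, 0 ≤ s → s * (a * b) = Real.sqrt s * a * (Real.sqrt s * b) := by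
              intro s a b hs
              rw [show Real.sqrt s * a * (Real.sqrt s * b) = (Real.sqrt s * Real.sqrt s) * (a * b) by
                ring, Real.mul_self_sqrt hs]
            exact key _ _ _ (hφ0 x)
    -- Cauchy–Schwarz in `L²`
    have hma : MemLp a (ENNReal.ofReal 2) ν := hac.memLp_of_hasCompactSupport has
    have hmb : MemLp b (ENNReal.ofReal 2) ν := hbc.memLp_of_hasCompactSupport hbs
    have hCS := integral_mul_le_Lp_mul_Lq_of_nonneg Real.HolderConjugate.two_two
      (Eventually.of_forall fun x ↦ Real.sqrt_nonneg _) (Eventually.of_forall fun x ↦ Real.sqrt_nonneg _)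
      hma hmb
    have ha2 : ∫ x, a x ^ (2 : ℝ) ∂ν ≤ ∫ x, (ofRiemannian h).gradSq (χ - v n) x ∂ν := by
      obtain ⟨-, -, hIw⟩ : Continuous ((ofRiemannian h).gradSq (χ - v n)) ∧ HasCompactSupport ((ofRiemannian h).gradSq (χ - v n)) ∧
          Integrable ((ofRiemannian h).gradSq (χ - v n)) ν := by
        refine ⟨hgc, ?_, ?_⟩
        · refine HasCompactSupport.of_support_subset_isCompact (hK₁.union (hvc n).isCompact)
            fun x hx ↦ ?_
          by_contra hx'
          simp only [mem_union, not_or] at hx'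
          apply hx
          have hd : mvfderiv I (χ - v n) x = 0 := by
            rw [mvfderiv_sub ((hχ x).mdifferentiableAt (by simp)) ((hv n x).mdifferentiableAt (by simp)),
              hχK x hx'.1, mvfderiv_eq_zero_of_notMem_tsupport hx'.2, sub_zero]
          simp [PseudoRiemannianMetric.gradSq, PseudoRiemannianMetric.innerDual, hd]
        · exact hgc.integrable_of_hasCompactSupport (HasCompactSupport.of_support_subset_isCompact
            (hK₁.union (hvc n).isCompact) fun x hx ↦ by
              by_contra hx'
              simp only [mem_union, not_or] at hx'
              apply hx
              have hd : mvfderiv I (χ - v n) x = 0 := by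
                rw [mvfderiv_sub ((hχ x).mdifferentiableAt (by simp))
                  ((hv n x).mdifferentiableAt (by simp)), hχK x hx'.1,
                  mvfderiv_eq_zero_of_notMem_tsupport hx'.2, sub_zero]
              simp [PseudoRiemannianMetric.gradSq, PseudoRiemannianMetric.innerDual, hd])
      refine integral_mono_of_nonneg (Eventually.of_forall fun x ↦ Real.rpow_nonneg (Real.sqrt_nonneg _) _)
        hIw (Eventually.of_forall fun x ↦ ?_)
      rw [ha]; dsimp only
      rw [Real.rpow_two, Real.sq_sqrt (mul_nonneg (hφ0 x) (hgn0 x))]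
      exact (mul_le_of_le_one_left (hgn0 x) (hφ1 x))
    have hb2 : ∫ x, b x ^ (2 : ℝ) ∂ν = T := by
      rw [hTdef]
      refine integral_congr_ae (Eventually.of_forall fun x ↦ ?_)
      rw [hb]; dsimp only
      rw [Real.rpow_two, Real.sq_sqrt (mul_nonneg (hφ0 x) (hG0 x))]
    have hIab : Integrable (fun x ↦ a x * b x) ν :=
      (hac.mul hbc).integrable_of_hasCompactSupport has.mul_right
    calc |Tn n| ≤ ∫ x, |φ x * (ofRiemannian h).innerDual x (mvfderiv I (χ - v n) x).toLinearMap
          (mvfderiv I ũ x).toLinearMap| ∂ν := abs_integral_le_integral_abs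
      _ ≤ ∫ x, a x * b x ∂ν := by
          refine integral_mono_of_nonneg (Eventually.of_forall fun x ↦ abs_nonneg _) hIab
            (Eventually.of_forall hpt)
      _ ≤ (∫ x, a x ^ (2 : ℝ) ∂ν) ^ (1 / (2 : ℝ)) * (∫ x, b x ^ (2 : ℝ) ∂ν) ^ (1 / (2 : ℝ)) := hCS
      _ ≤ Real.sqrt (∫ x, (ofRiemannian h).gradSq (χ - v n) x ∂ν) * Real.sqrt T := by
          rw [hb2, Real.sqrt_eq_rpow, Real.sqrt_eq_rpow]
          refine mul_le_mul_of_nonneg_right (Real.rpow_le_rpow ?_ ha2 (by norm_num))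
            (Real.rpow_nonneg hT0 _)
          exact integral_nonneg fun x ↦ Real.rpow_nonneg (Real.sqrt_nonneg _) _
  -- pass to the limit: `T ≤ √m' √T`
  have hm0 : 0 ≤ m' :=
    ge_of_tendsto' hE fun n ↦ integral_nonneg fun x ↦ innerDual_self_nonneg (h := h) x _
  have hle : T ≤ Real.sqrt m' * Real.sqrt T := by
    have h1 : Tendsto (fun n ↦ Real.sqrt (∫ x, (ofRiemannian h).gradSq (χ - v n) x ∂ν) * Real.sqrt T) atTop
        (𝓝 (Real.sqrt m' * Real.sqrt T)) :=
      ((Real.continuous_sqrt.tendsto m').comp hE).mul tendsto_const_nhds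
    have h2 : Tendsto (fun n ↦ |Tn n|) atTop (𝓝 |T|) := (continuous_abs.tendsto T).comp hlim
    have h3 := le_of_tendsto_of_tendsto' h2 h1 hbound
    rwa [abs_of_nonneg hT0] at h3
  -- conclude `T ≤ m'`
  by_cases hT : T = 0
  · rw [hT]; exact hm0
  · have hTpos : 0 < T := lt_of_le_of_ne hT0 (Ne.symm hT)
    have hsT : 0 < Real.sqrt T := Real.sqrt_pos.2 hTpos
    have h1 : Real.sqrt T * Real.sqrt T ≤ Real.sqrt m' * Real.sqrt T := by
      rw [Real.mul_self_sqrt hT0]; exact hle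
    have h2 : Real.sqrt T ≤ Real.sqrt m' := le_of_mul_le_mul_right h1 hsT
    calc T = Real.sqrt T ^ 2 := (Real.sq_sqrt hT0).symm
      _ ≤ Real.sqrt m' ^ 2 := pow_le_pow_left₀ (Real.sqrt_nonneg _) h2 2
      _ = m' := Real.sq_sqrt hm0

omit [I.Boundaryless] [(ofRiemannian h).HasLeviCivita] in
/-- **From the cutoff bounds to the global energy bound**: if `G ≥ 0` is continuous and
`∫ φ G dV_h ≤ m'` for every `φ ∈ C_c^∞(N; [0, 1])`, then `∫⁻ ofReal G dV_h ≤ ofReal m'` (exhaust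
`N` by compacts `K_k` (`CompactExhaustion`), take smooth `φ_k = 1` on `K_k` supported in `K_{k+1}`
(smooth Urysohn), and use monotone convergence). [folklore] -/
theorem lintegral_ofReal_le_of_forall_cutoff {G : N → ℝ} (hGc : Continuous G) (hG0 : ∀ x, 0 ≤ G x)
    {m' : ℝ} (hcut : ∀ φ : N → ℝ, ContMDiff I 𝓘(ℝ, ℝ) ∞ φ → HasCompactSupport φ →
      (∀ x, 0 ≤ φ x) → (∀ x, φ x ≤ 1) → ∫ x, φ x * G x ∂riemannianMeasure h ≤ m') :
    ∫⁻ x, ENNReal.ofReal (G x) ∂riemannianMeasure h ≤ ENNReal.ofReal m' := by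
  haveI : LocallyCompactSpace N := Manifold.locallyCompact_of_finiteDimensional I
  haveI : IsFiniteMeasureOnCompacts (riemannianMeasure h) :=
    ⟨fun K hK ↦ riemannianVolume_lt_top_of_isCompact_holds h le_rfl hK⟩
  set K := CompactExhaustion.choice N with hK
  -- the truncated integrals are bounded by `m'`
  have hk : ∀ k : ℕ, ∫⁻ x, (K k).indicator (fun x ↦ ENNReal.ofReal (G x)) x ∂riemannianMeasure h ≤
      ENNReal.ofReal m' := by
    intro k
    obtain ⟨f, hf0, hf1, hf01⟩ := exists_contMDiffMap_zero_one_of_isClosed (I := I) (n := (⊤ : ℕ∞))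
      isOpen_interior.isClosed_compl (K.isCompact k).isClosed
      (disjoint_compl_left_iff.2 (K.subset_interior_succ k))
    have hfs : ContMDiff I 𝓘(ℝ, ℝ) ∞ f := f.contMDiff
    have hfc : HasCompactSupport (f : N → ℝ) := by
      refine HasCompactSupport.of_support_subset_isCompact (K.isCompact (k + 1)) fun x hx ↦ ?_
      by_contra hx'
      exact hx (hf0 (show x ∈ (interior (K (k + 1)))ᶜ from fun h' ↦ hx' (interior_subset h')))
    have hbd := hcut f hfs hfc (fun x ↦ (hf01 x).1) (fun x ↦ (hf01 x).2)
    have hI : Integrable (fun x ↦ f x * G x) (riemannianMeasure h) :=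
      (f.contMDiff.continuous.mul hGc).integrable_of_hasCompactSupport hfc.mul_right
    calc ∫⁻ x, (K k).indicator (fun x ↦ ENNReal.ofReal (G x)) x ∂riemannianMeasure h
        ≤ ∫⁻ x, ENNReal.ofReal (f x * G x) ∂riemannianMeasure h := by
          refine lintegral_mono fun x ↦ ?_
          by_cases hx : x ∈ K k
          · rw [indicator_of_mem hx, hf1 hx, Pi.one_apply, one_mul]
          · rw [indicator_of_notMem hx]; exact zero_le
      _ = ENNReal.ofReal (∫ x, f x * G x ∂riemannianMeasure h) :=
          (ofReal_integral_eq_lintegral_ofReal hI (Eventually.of_forall fun x ↦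
            mul_nonneg (hf01 x).1 (hG0 x))).symm
      _ ≤ ENNReal.ofReal m' := ENNReal.ofReal_le_ofReal hbd
  -- monotone convergence along the exhaustion
  have hmeas : ∀ k, Measurable ((K k).indicator fun x ↦ ENNReal.ofReal (G x)) := fun k ↦
    (hGc.measurable.ennreal_ofReal).indicator (K.isCompact k).isClosed.measurableSet
  have hmono : Monotone fun k ↦ (K k).indicator fun x ↦ ENNReal.ofReal (G x) := fun i j hij ↦
    indicator_le_indicator_of_subset (K.subset hij) fun _ ↦ zero_le
  have hsup : ∀ x, (⨆ k, (K k).indicator (fun x ↦ ENNReal.ofReal (G x)) x) = ENNReal.ofReal (G x) := by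
    intro x
    refine le_antisymm (iSup_le fun k ↦ indicator_le_self _ _ x) ?_
    obtain ⟨k, hxk⟩ := K.exists_mem x
    exact le_iSup_of_le k (by rw [indicator_of_mem hxk])
  calc ∫⁻ x, ENNReal.ofReal (G x) ∂riemannianMeasure h
      = ∫⁻ x, ⨆ k, (K k).indicator (fun x ↦ ENNReal.ofReal (G x)) x ∂riemannianMeasure h :=
        lintegral_congr fun x ↦ (hsup x).symm
    _ = ⨆ k, ∫⁻ x, (K k).indicator (fun x ↦ ENNReal.ofReal (G x)) x ∂riemannianMeasure h :=
        lintegral_iSup hmeas hmono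
    _ ≤ ENNReal.ofReal m' := iSup_le hk

end Energy

end Literature.Geometry.Riemannian

end
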